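import Summits.Ventures.PercRepro.ProfilePointedMirror
import Summits.Ventures.PercRepro.ProfilePointedContainment

/-!
# PercRepro — THE PER-CIRCUIT CLASSES OF THE CAPTURED FAMILY AND THE CO-RANK-5 TOP THRESHOLD AT NULLITY 4
(p5, gen 36; `proofs/P5-GM1.md` §46(c), §50–§52)

For a point `x` of a finite matroid `N`, a captured bi-independent set `W` (`x ∉ W`, `x ∈ cl W`) has a unique
fundamental circuit `C(x, W) ⊆ W ∪ x`; `fundC N W x := {w ∈ W : x ∉ cl(W ∖ w)}` is that circuit without `x`.
`gammaC N k x C` counts the captured `k`-sets at `x` whose fundamental circuit (without `x`) is `C` (§46(c)'s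
`γ_C(k)`), so `κ_k(x) = Σ_C γ_C(k)` (`capCount_eq_sum_gammaC`).

THE BOTTOM-LEVEL PER-CIRCUIT CLAIM AT NULLITY 4 (`gammaC_four_le_of_nullity_four`, §52(b): proved on paper by the
disjointness LYM inside each class — `#C ∪ x = 2`: the kernel's `biIndep_step_three_of_nullity_three` on
`N ／ w ∖ x`; `= 3, 4, 5`: explicit injections; `≥ 6`: no captured set — NOT YET FORMALIZED, `sorry` below) gives
`κ_4(x) ≤ κ_{n−5}(x)`, hence `out_4(x) ≤ in_5(x)` by the mirror identity, hence Theorem A's step at the level `4`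
on every matroid with four more points than its rank (`biIndep_step_four_of_nullity_four`), hence THE CO-RANK-5
TOP THRESHOLD ON EVERY MATROID WITH `#E ≤ ρ(E) + 4` AND `ρ(E) ≥ 5` (`thresholdIneq_five_top_of_nullity_le_four`),
UNCONDITIONALLY — the unconditional form of `thresholdIneq_five_top_of_nullity_le_four_of_unimodal`.

THIS MODULE (no `sorry`): the definitions, the per-circuit split `capCount_eq_sum_gammaC`, the superset lemma
`fundC_eq_of_subset`, the extension lemma `exists_indep_erase_superset_card_rk`, and the classes `#C ≥ 5` (empty),
`#C = 4` (`Δ ≤ 1 ≤ U`) and `#C = 3` (the double counting with the uniform bound `ρ − 4`); the classes `#C ≤ 2` and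
the assembly are in `ProfilePointedCircuitClassesTop`.
-/

open scoped Matroid

namespace PercRepro.Cogirth

open Finset ThmH Skew Shadow Profile

variable {α : Type} [DecidableEq α] {N : Matroid α} [N.Finite]

section CircuitClasses

/-- The fundamental circuit of `x` in `W`, without `x`: the points `w ∈ W` whose removal frees `x`. -/
noncomputable def fundC (N : Matroid α) [N.Finite] (W : Finset α) (x : α) : Finset α :=
  W.filter (fun w => x ∉ clF N (W.erase w))

/-- `fundC N W x ⊆ W`. -/
theorem fundC_subset (W : Finset α) (x : α) : fundC N W x ⊆ W := filter_subset _ _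

/-- `γ_C(k)`: the captured bi-independent `k`-sets at `x` whose fundamental circuit without `x` is `C`. -/
noncomputable def gammaC (N : Matroid α) [N.Finite] (k : ℕ) (x : α) (C : Finset α) : ℕ :=
  ((biIndepSets N k).filter (fun W => x ∉ W ∧ x ∈ clF N W ∧ fundC N W x = C)).card

/-- `κ_k(x) = Σ_C γ_C(k)`: the captured family splits by the fundamental circuit (§46(c)). -/
theorem capCount_eq_sum_gammaC (k : ℕ) (x : α) :
    capCount N k x = ∑ C ∈ (gr N).powerset, gammaC N k x C := by
  unfold capCount gammaC
  rw [card_eq_sum_card_fiberwise (f := fun W => fundC N W x) (t := (gr N).powerset)]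
  · apply sum_congr rfl
    intro C _
    rw [filter_filter]
    apply congrArg
    apply filter_congr
    intro W _
    tauto
  · intro W hW
    rw [mem_coe, mem_filter] at hW
    rw [mem_coe, mem_powerset]
    exact (fundC_subset W x).trans (mem_biIndepSets.1 hW.1).1

/-- A captured set of the class `C` contains `C`. -/
theorem subset_of_mem_gammaC_filter {k : ℕ} {x : α} {C W : Finset α}
    (hW : W ∈ (biIndepSets N k).filter (fun W => x ∉ W ∧ x ∈ clF N W ∧ fundC N W x = C)) : C ⊆ W := by
  rw [mem_filter] at hW
  rw [← hW.2.2.2]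
  exact fundC_subset W x

/-- No captured `k`-set belongs to a class `C` with more than `k` points. -/
theorem gammaC_eq_zero_of_lt_card {k : ℕ} {x : α} {C : Finset α} (hC : k < C.card) : gammaC N k x C = 0 := by
  unfold gammaC
  rw [card_eq_zero, filter_eq_empty_iff]
  intro W hW hWC
  have h1 : C ⊆ W := subset_of_mem_gammaC_filter (mem_filter.2 ⟨hW, hWC⟩)
  have h2 : W.card = k := (mem_biIndepSets.1 hW).2.1
  have h3 := card_le_card h1
  omega

/-- **THE CLASS IS STABLE UNDER INDEPENDENT SUPERSETS** (§47(a)): if `W ⊆ V` are captured sets at `x` with the same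
ambient independence, `x ∈ cl C` and `fundC N W x = C`, then `fundC N V x = C` — a point `w ∉ C` keeps `x` in the
closure of `V − w ⊇ C`, and for `w ∈ C` submodularity on `V − w + x` and `W + x` (whose union is `V + x` and whose
intersection is `W − w + x`) forbids `x ∈ cl(V − w)`. -/
theorem fundC_eq_of_subset {x : α} {C W V : Finset α} (hWg : W ⊆ gr N) (hWrk : rk N W = W.card)
    (hxcl : x ∈ clF N W) (hfund : fundC N W x = C) (hxC : x ∈ clF N C) (hWV : W ⊆ V) (hVg : V ⊆ gr N)
    (hVrk : rk N V = V.card) (hxclV : x ∈ clF N V) : fundC N V x = C := by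
  have hCW : C ⊆ W := hfund ▸ fundC_subset W x
  ext w
  unfold fundC
  rw [mem_filter]
  constructor
  · rintro ⟨hwV, hxcl'⟩
    by_contra hwC
    have hsub' : C ⊆ V.erase w := by
      intro w' hw'
      rw [mem_erase]
      exact ⟨fun h => hwC (h ▸ hw'), hWV (hCW hw')⟩
    exact hxcl' (mem_clF_of_subset hsub' hxC)
  · intro hwC
    have hwW : w ∈ W := hCW hwC
    refine ⟨hWV hwW, ?_⟩
    intro hxcl'
    have hwf : w ∈ fundC N W x := by rw [hfund]; exact hwC
    unfold fundC at hwf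
    rw [mem_filter] at hwf
    have hWe : W.erase w ⊆ gr N := (erase_subset w W).trans hWg
    have hVe : V.erase w ⊆ gr N := (erase_subset w V).trans hVg
    have hxg : x ∈ gr N := clF_subset_gr W hxcl
    have r1 : rk N (insert x (W.erase w)) = rk N (W.erase w) + 1 := by
      rw [rk_insert_eq hxg hWe, if_neg hwf.2]
    have r2 : rk N (insert x (V.erase w)) = rk N (V.erase w) := by
      rw [rk_insert_eq hxg hVe, if_pos hxcl']
    have r3 : rk N (insert x W) = rk N W := by
      rw [rk_insert_eq hxg hWg, if_pos hxcl]
    have r4 : rk N (insert x V) = rk N V := by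
      rw [rk_insert_eq hxg hVg, if_pos hxclV]
    have rWe : rk N (W.erase w) = W.card - 1 := by
      rw [rk_eq_card_of_subset_of_rk_eq_card (erase_subset w W) hWrk, card_erase_of_mem hwW]
    have rVe : rk N (V.erase w) = V.card - 1 := by
      rw [rk_eq_card_of_subset_of_rk_eq_card (erase_subset w V) hVrk, card_erase_of_mem (hWV hwW)]
    have hsm := rk_union_add_rk_inter_le (M := N) (insert x (V.erase w)) (insert x W)
    have hU : insert x (V.erase w) ∪ insert x W = insert x V := by
      ext a
      simp only [mem_union, mem_insert, mem_erase]
      constructor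
      · rintro (⟨h | ⟨hne, hV'⟩⟩ | ⟨h | hW'⟩)
        · exact Or.inl h
        · exact Or.inr hV'
        · exact Or.inl h
        · exact Or.inr (hWV hW')
      · rintro (h | hV')
        · exact Or.inl (Or.inl h)
        · by_cases haw : a = w
          · exact Or.inr (Or.inr (haw ▸ hwW))
          · exact Or.inl (Or.inr ⟨haw, hV'⟩)
    have hI : insert x (V.erase w) ∩ insert x W = insert x (W.erase w) := by
      ext a
      simp only [mem_inter, mem_insert, mem_erase]
      constructor
      · rintro ⟨h1 | ⟨hne, hV'⟩, h2 | hW'⟩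
        · exact Or.inl h1
        · exact Or.inl h1
        · exact Or.inl h2
        · exact Or.inr ⟨hne, hW'⟩
      · rintro (h | ⟨hne, hW'⟩)
        · exact ⟨Or.inl h, Or.inl h⟩
        · exact ⟨Or.inr ⟨hne, hWV hW'⟩, Or.inr hW'⟩
    rw [hU, hI, r1, r2, r3, r4, rWe, rVe, hWrk, hVrk] at hsm
    have hW1 : 1 ≤ W.card := card_pos.2 ⟨w, hwW⟩
    have hV1 : 1 ≤ V.card := card_pos.2 ⟨w, hWV hwW⟩
    omega

/-- **THE CLASS `#C = 4`** (`#(C ∪ x) = 5`; §52(b): `Δ ≤ 1 ≤ U`): at most one captured `4`-set (`W = C` itself), and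
if it is there then so is a captured `(n − 5)`-set of the class — a basis `J ⊇ W` of `E − x` minus a point of
`J ∖ W` (p10's `exists_mem_capLevel_superset` and the superset lemma). -/
theorem gammaC_four_le_of_card_eq_four (hn : (gr N).card = rk N (gr N) + 4) (hR : 6 ≤ rk N (gr N))
    (x : α) {C : Finset α} (hC : C.card = 4) : gammaC N 4 x C ≤ gammaC N ((gr N).card - 5) x C := by
  unfold gammaC
  -- every captured `4`-set of the class is `C` itself
  have hsub : ∀ W ∈ (biIndepSets N 4).filter (fun W => x ∉ W ∧ x ∈ clF N W ∧ fundC N W x = C), W = C := by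
    intro W hW
    have h1 : C ⊆ W := subset_of_mem_gammaC_filter hW
    have h2 : W.card = 4 := (mem_biIndepSets.1 (mem_filter.1 hW).1).2.1
    exact (eq_of_subset_of_card_le h1 (by omega)).symm
  rcases ((biIndepSets N 4).filter (fun W => x ∉ W ∧ x ∈ clF N W ∧ fundC N W x = C)).eq_empty_or_nonempty
    with hemp | ⟨W, hW⟩
  · rw [hemp, card_empty]
    exact Nat.zero_le _
  have hle : ((biIndepSets N 4).filter (fun W => x ∉ W ∧ x ∈ clF N W ∧ fundC N W x = C)).card ≤ 1 :=
    card_le_one.2 (fun a ha b hb => by rw [hsub a ha, hsub b hb])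
  have hWC := hsub W hW
  subst hWC
  rw [mem_filter, mem_biIndepSets] at hW
  obtain ⟨⟨hWg, hWcard, hWrk, hWcompl⟩, hxW, hxcl, hfund⟩ := hW
  -- `W` is captured at the level `4`; take a captured superset at the level `n − 4` and drop a point of it
  have hWcap : W ∈ capLevel N x 4 := by
    rw [mem_capLevel, mem_capSets, mem_biIndepAll]
    exact ⟨⟨⟨⟨hWg, hWrk, hWcompl⟩, hxW⟩, hxcl⟩, hWcard⟩
  obtain ⟨X', hX', hWX'⟩ := exists_mem_capLevel_superset (M := N) (p := x) (k := 4) (by omega) hWcap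
  rw [mem_capLevel, mem_capSets, mem_biIndepAll] at hX'
  obtain ⟨⟨⟨⟨hX'g, hX'rk, hX'compl⟩, hxX'⟩, hxclX'⟩, hX'card⟩ := hX'
  have hlt : W.card < X'.card := by omega
  obtain ⟨u, huX', huW⟩ := exists_mem_notMem_of_card_lt_card hlt
  -- the target `V := X' − u`
  set V := X'.erase u with hV
  have hVX' : V ⊆ X' := erase_subset u X'
  have hWV : W ⊆ V := by
    intro w hw
    rw [hV, mem_erase]
    exact ⟨fun h => huW (h ▸ hw), hWX' hw⟩
  have hVg : V ⊆ gr N := hVX'.trans hX'g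
  have hVcard : V.card = (gr N).card - 5 := by
    rw [hV, card_erase_of_mem huX', hX'card]
    omega
  have hVrk : rk N V = V.card := rk_eq_card_of_subset_of_rk_eq_card hVX' hX'rk
  have hVcompl : rk N (gr N \ V) = (gr N \ V).card :=
    rk_eq_card_of_subset_of_rk_eq_card (sdiff_subset_sdiff (Subset.refl _) hWV) hWcompl
  have hxV : x ∉ V := fun h => hxX' (hVX' h)
  have hxclV : x ∈ clF N V := mem_clF_of_subset hWV hxcl
  have hfundV : fundC N V x = W :=
    fundC_eq_of_subset hWg hWrk hxcl hfund (hfund ▸ hxcl) hWV hVg hVrk hxclV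
  -- hence the level-`(n − 5)` class is non-empty
  have hpos : 0 < ((biIndepSets N ((gr N).card - 5)).filter
      (fun Y => x ∉ Y ∧ x ∈ clF N Y ∧ fundC N Y x = W)).card :=
    card_pos.2 ⟨V, mem_filter.2 ⟨mem_biIndepSets.2 ⟨hVg, hVcard, hVrk, hVcompl⟩, hxV, hxclV, hfundV⟩⟩
  omega

/-- A captured set `W` at `x` extends to an independent subset `J ⊆ E − x` of size `ρ(E)` (a basis of `E − x`, whose
rank is `ρ(E)` because `x ∈ cl W ⊆ cl(E − x)`) — p10's extension step of `exists_mem_capLevel_superset`. -/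
theorem exists_indep_erase_superset_card_rk {x : α} {W : Finset α} (hWg : W ⊆ gr N) (hWrk : rk N W = W.card)
    (hxW : x ∉ W) (hxcl : x ∈ clF N W) :
    ∃ J : Finset α, W ⊆ J ∧ J ⊆ (gr N).erase x ∧ rk N J = J.card ∧ J.card = rk N (gr N) := by
  have hXE' : W ⊆ (gr N).erase x := by
    intro w hw
    rw [mem_erase]
    exact ⟨fun h => hxW (h ▸ hw), hWg hw⟩
  have hpE' : x ∈ clF N ((gr N).erase x) := mem_clF_of_subset hXE' hxcl
  have hgr_sub : gr N ⊆ clF N ((gr N).erase x) := by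
    intro w hw
    by_cases hwx : w = x
    · rw [hwx]
      exact hpE'
    · exact subset_clF_self_of_subset_gr (erase_subset _ _) (mem_erase.2 ⟨hwx, hw⟩)
  have hrkE' : rk N ((gr N).erase x) = rk N (gr N) := by
    have h1 : rk N ((gr N).erase x) ≤ rk N (gr N) := rk_le_rk_of_subset_finset (erase_subset _ _)
    have h2 : rk N (gr N) ≤ rk N (clF N ((gr N).erase x)) := rk_le_rk_of_subset_finset hgr_sub
    rw [rk_clF_eq_rk] at h2
    omega
  have hXind : N.Indep (W : Set α) := indep_of_rk_eq_card' hWrk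
  have hE'E : (((gr N).erase x : Finset α) : Set α) ⊆ N.E := by
    rw [← coe_gr]
    exact_mod_cast erase_subset x (gr N)
  obtain ⟨J, hJ, hXJ⟩ := hXind.subset_isBasis_of_subset (by exact_mod_cast hXE') hE'E
  have hJfin : J.Finite := (Finset.finite_toSet _).subset hJ.subset
  have hJ'J : (hJfin.toFinset : Set α) = J := Set.Finite.coe_toFinset hJfin
  have hJ'card : hJfin.toFinset.card = rk N ((gr N).erase x) := by
    have h1 := hJ.encard_eq_eRk
    rw [← hJ'J, Set.encard_coe_eq_coe_finsetCard, ← coe_rk] at h1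
    exact_mod_cast h1
  refine ⟨hJfin.toFinset, ?_, ?_, ?_, ?_⟩
  · intro w hw
    rw [Set.Finite.mem_toFinset]
    exact hXJ hw
  · intro w hw
    rw [Set.Finite.mem_toFinset] at hw
    exact_mod_cast hJ.subset hw
  · refine rk_eq_card_of_indep' (hJ.indep.subset ?_)
    rw [hJ'J]
  · rw [hJ'card, hrkE']

/-- **THE CLASS `#C = 3`** (`#(C ∪ x) = 4`; §52(b), the `#D = 4` case, as a double counting of the containment edges
demand ⊆ unit with the uniform bound `ρ − 4`): every demand `W = C + p` has at least `ρ − 4` units above it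
(`J − b`, `b ∈ J ∖ W`, for a basis `J ⊇ W` of `E − x`), every unit `V` has at most `ρ − 4` demands below it
(`W ↦ W ∖ C`, a point of `V ∖ C`), so `(ρ − 4)·Δ ≤ #edges ≤ (ρ − 4)·U`. -/
theorem gammaC_four_le_of_card_eq_three (hn : (gr N).card = rk N (gr N) + 4) (hR : 6 ≤ rk N (gr N))
    (x : α) {C : Finset α} (hC : C.card = 3) : gammaC N 4 x C ≤ gammaC N ((gr N).card - 5) x C := by
  unfold gammaC
  set D := (biIndepSets N 4).filter (fun W => x ∉ W ∧ x ∈ clF N W ∧ fundC N W x = C) with hD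
  set U := (biIndepSets N ((gr N).card - 5)).filter (fun V => x ∉ V ∧ x ∈ clF N V ∧ fundC N V x = C) with hU
  -- every demand `W = C + p` has at least `ρ − 4` units above it: `J − b`, `b ∈ J ∖ W`, for a basis `J ⊇ W` of `E − x`
  have hdeg : ∀ W ∈ D, rk N (gr N) - 4 ≤ (U.filter (fun V => W ⊆ V)).card := by
    intro W hW
    rw [hD, mem_filter, mem_biIndepSets] at hW
    obtain ⟨⟨hWg, hWcard, hWrk, hWcompl⟩, hxW, hxcl, hfund⟩ := hW
    have hCW : C ⊆ W := hfund ▸ fundC_subset W x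
    obtain ⟨p, hpW, hpC⟩ := exists_mem_notMem_of_card_lt_card (show C.card < W.card by omega)
    have hWe : W.erase p = C := by
      apply (eq_of_subset_of_card_le _ _).symm
      · intro c hc
        rw [mem_erase]
        exact ⟨fun h => hpC (h ▸ hc), hCW hc⟩
      · rw [card_erase_of_mem hpW]
        omega
    have hxC : x ∈ clF N C := by
      have hpf : p ∉ fundC N W x := by rw [hfund]; exact hpC
      unfold fundC at hpf
      rw [mem_filter, not_and] at hpf
      have h := not_not.1 (hpf hpW)
      rw [hWe] at h
      exact h
    obtain ⟨J, hWJ, hJE, hJrk, hJcard⟩ := exists_indep_erase_superset_card_rk hWg hWrk hxW hxcl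
    have hJg : J ⊆ gr N := hJE.trans (erase_subset _ _)
    have hxJ : x ∉ J := fun h => (mem_erase.1 (hJE h)).1 rfl
    have hmaps : ∀ b ∈ J \ W, J.erase b ∈ U.filter (fun V => W ⊆ V) := by
      intro b hb
      rw [mem_sdiff] at hb
      have hWV : W ⊆ J.erase b := by
        intro w hw
        rw [mem_erase]
        exact ⟨fun h => hb.2 (h ▸ hw), hWJ hw⟩
      have hVg : J.erase b ⊆ gr N := (erase_subset _ _).trans hJg
      have hVrk : rk N (J.erase b) = (J.erase b).card := rk_eq_card_of_subset_of_rk_eq_card (erase_subset _ _) hJrk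
      have hxV : x ∉ J.erase b := fun h => hxJ (erase_subset _ _ h)
      have hxclV : x ∈ clF N (J.erase b) := mem_clF_of_subset hWV hxcl
      rw [mem_filter, hU, mem_filter, mem_biIndepSets]
      refine ⟨⟨⟨hVg, ?_, hVrk, ?_⟩, hxV, hxclV, ?_⟩, hWV⟩
      · rw [card_erase_of_mem hb.1, hJcard]
        omega
      · exact rk_eq_card_of_subset_of_rk_eq_card (sdiff_subset_sdiff (Subset.refl _) hWV) hWcompl
      · exact fundC_eq_of_subset hWg hWrk hxcl hfund hxC hWV hVg hVrk hxclV
    have hinj : Set.InjOn (fun b => J.erase b) (J \ W : Finset α) := by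
      intro b hb b' hb' hbb'
      rw [mem_coe, mem_sdiff] at hb hb'
      by_contra hne
      have : b ∈ J.erase b' := mem_erase.2 ⟨hne, hb.1⟩
      simp only at hbb'
      rw [← hbb'] at this
      exact (mem_erase.1 this).1 rfl
    calc rk N (gr N) - 4 = (J \ W).card := by
          rw [card_sdiff_of_subset hWJ, hJcard, hWcard]
      _ ≤ (U.filter (fun V => W ⊆ V)).card := card_le_card_of_injOn _ hmaps hinj
  -- every unit `V` has at most `ρ − 4` demands below it: `W ↦ W ∖ C`, a point of `V ∖ C`
  have hco : ∀ V ∈ U, (D.filter (fun W => W ⊆ V)).card ≤ rk N (gr N) - 4 := by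
    intro V hV
    rw [hU, mem_filter, mem_biIndepSets] at hV
    obtain ⟨⟨hVg, hVcard, hVrk, hVcompl⟩, hxV, hxclV, hfundV⟩ := hV
    have hCV : C ⊆ V := hfundV ▸ fundC_subset V x
    have hmaps : ∀ W ∈ D.filter (fun W => W ⊆ V), W \ C ∈ powersetCard 1 (V \ C) := by
      intro W hW
      rw [mem_filter] at hW
      obtain ⟨hWD, hWV⟩ := hW
      rw [hD, mem_filter, mem_biIndepSets] at hWD
      obtain ⟨⟨_, hWcard, _, _⟩, _, _, hfund⟩ := hWD
      have hCW : C ⊆ W := hfund ▸ fundC_subset W x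
      rw [mem_powersetCard]
      refine ⟨sdiff_subset_sdiff hWV (Subset.refl _), ?_⟩
      rw [card_sdiff_of_subset hCW, hWcard, hC]
    have hinj : Set.InjOn (fun W => W \ C) (D.filter (fun W => W ⊆ V) : Finset (Finset α)) := by
      intro W hW W' hW' h
      rw [mem_coe, mem_filter, hD, mem_filter] at hW hW'
      have hCW : C ⊆ W := hW.1.2.2.2 ▸ fundC_subset W x
      have hCW' : C ⊆ W' := hW'.1.2.2.2 ▸ fundC_subset W' x
      rw [← sdiff_union_of_subset hCW, ← sdiff_union_of_subset hCW']
      simp only at h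
      rw [h]
    calc (D.filter (fun W => W ⊆ V)).card ≤ (powersetCard 1 (V \ C)).card := card_le_card_of_injOn _ hmaps hinj
      _ = rk N (gr N) - 4 := by
          rw [card_powersetCard, Nat.choose_one_right, card_sdiff_of_subset hCV, hVcard, hC]
          omega
  -- the double counting of the containment edges
  have h := sum_card_bipartiteAbove_eq_sum_card_bipartiteBelow (r := fun (W V : Finset α) => W ⊆ V) (s := D) (t := U)
  simp only [bipartiteAbove, bipartiteBelow] at h
  have h1 : D.card * (rk N (gr N) - 4) ≤ ∑ W ∈ D, (U.filter (fun V => W ⊆ V)).card := by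
    rw [← smul_eq_mul]
    exact card_nsmul_le_sum _ _ _ hdeg
  have h2 : ∑ V ∈ U, (D.filter (fun W => W ⊆ V)).card ≤ U.card * (rk N (gr N) - 4) := by
    rw [← smul_eq_mul]
    exact sum_le_card_nsmul _ _ _ hco
  have h3 : D.card * (rk N (gr N) - 4) ≤ U.card * (rk N (gr N) - 4) := by omega
  exact Nat.le_of_mul_le_mul_right h3 (by omega)

end CircuitClasses

end PercRepro.Cogirth
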